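import Summits.Parity.BatemanHorn.Theorems.SoloInformedHooleyUniformFrequency

/-!
# Hooley's bound with an explicit logarithmic rate, uniformly in the frequency

Informed soloist `solo-Parity-informed` (session 158), conjunct `BatemanHorn`, the `d ≥ 3` rung BELOW the parity
wall (Erdős's divisor sum `S_g(x) = ∑_{n ≤ x} τ(|g(n)|)` and the located root count `Mid_g`).

`SoloInformedHooleyProfileGrowingScale` ran the tree's parameter choice for Hooley's theorem
(`log z = log x/(ε log log x)`, `ε = δ/(2 log n)`, `t = 3(2 + δ/2)/ε`) on the frequency-uniform explicit bound
`exists_norm_sum_polyRootWeylSum_le_sqrt_mul` and kept only the qualitative conclusion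
`|∑_{k ≤ x} S_g(h,k)| ≤ c·√|h|·x` eventually, for every `c > 0`.  The same computation yields a RATE: the
bound produced there is `√|h| · x · Ψ(log log x)` with
`Ψ(s) = A₁ ε^δ s^δ e^{−(δ/2)s} + (A₂'/ε) e^{−s}`, and `Ψ(s) ≤ (A₁ ε^δ + A₂'/ε) · e^{−(δ/4) s}` as soon as
`s^δ e^{−(δ/4)s} ≤ 1`; since `e^{−(δ/4) log log x} = (log x)^{−δ/4}` this is

* `exists_eventually_norm_sum_polyRootWeylSum_le_logPow`: for `g ∈ ℤ[X]` irreducible of degree `≥ 2` there are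
  `δ₁ > 0` and `K ≥ 0` such that for all large `x` and ALL `h ≠ 0`,
  `|∑_{k ≤ x} S_g(h, k)| ≤ K · √|h| · x · (log x)^{−δ₁}`

— Hooley's theorem (C. Hooley, *On the distribution of the roots of polynomial congruences*, Mathematika 11
(1964) 39–49) with a power-of-logarithm saving, uniform in the frequency at the cost `√|h|`.  (The tree's
`hooley_polyRoots_logPowerSaving_holds` has the sharper exponent `δ_n = (n − √n)/n!` but an `h`-dependent
constant; here `δ₁ = δ/4` for the unspecified `0 < δ ≤ 1/2` of `exists_norm_sum_polyRootWeylSum_le_uniform`.)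
Also recorded: the block form `|∑_{E < e ≤ E'} S_g(h; e)| ≤ 2K √|h| E' (log E)^{−δ₁}` for `x₀ ≤ E ≤ E'`
(`norm_sum_Ioc_hooleySum_le_logPow`), which is the input of the growing-window equidistribution theorem of
`SoloInformedWindowEquidistributionRate`.
-/

namespace Summit.Parity.BatemanHorn.Theorems

open scoped BigOperators
open Finset Polynomial Filter Literature.NumberTheory.Sieve

/-- **Hooley's bound with a logarithmic rate, uniformly in the frequency.** [this work; Hooley 1964]
For `f ∈ ℤ[X]` irreducible of degree `≥ 2` there are `δ₁ > 0` and `K ≥ 0` such that for all large `x` and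
all `h ≠ 0`: `|∑_{k ≤ x} S_f(h, k)| ≤ K · √|h| · x · (log x)^{−δ₁}`. -/
theorem exists_eventually_norm_sum_polyRootWeylSum_le_logPow {f : ℤ[X]} (hirr : Irreducible f)
    (hdeg : 2 ≤ f.natDegree) :
    ∃ δ₁ : ℝ, 0 < δ₁ ∧ ∃ K : ℝ, 0 ≤ K ∧ ∀ᶠ x : ℕ in atTop, ∀ h : ℤ, h ≠ 0 →
      ‖∑ k ∈ Icc 1 x, polyRootWeylSum f k h‖ ≤
        K * Real.sqrt (h.natAbs) * x * Real.log x ^ (-δ₁) := by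
  obtain ⟨δ, hδ, hδ2, A₁, A₂, B, hA₁, hA₂, hB, hcore⟩ :=
    exists_norm_sum_polyRootWeylSum_le_sqrt_mul hirr hdeg
  set n : ℕ := f.natDegree with hn
  have hn2 : (2 : ℝ) ≤ n := by rw [hn]; exact_mod_cast hdeg
  have hn0 : (0 : ℝ) < n := by linarith
  have hlogn : 0 < Real.log n := Real.log_pos (by linarith)
  -- parameters (as in `eventually_forall_norm_sum_polyRootWeylSum_le`)
  set ε : ℝ := δ / (2 * Real.log n) with hε
  have hε0 : 0 < ε := by positivity
  have hεn : Real.log n * ε = δ / 2 := by rw [hε]; field_simp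
  set t : ℝ := 3 * (2 + δ / 2) / ε with ht
  have ht0 : 0 ≤ t := by positivity
  have htε : t / 3 * ε = 2 + δ / 2 := by rw [ht]; field_simp
  set A₂' : ℝ := A₂ * Real.exp (B * t * Real.exp t) with hA₂'
  have hA₂'0 : 0 ≤ A₂' := by positivity
  have hδ4 : 0 < δ / 4 := by positivity
  refine ⟨δ / 4, hδ4, A₁ * ε ^ δ + A₂' / ε, by positivity, ?_⟩
  -- basic limits in `x`
  have hL : Filter.Tendsto (fun x : ℕ => Real.log (x : ℝ)) Filter.atTop Filter.atTop :=
    Real.tendsto_log_atTop.comp tendsto_natCast_atTop_atTop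
  have hLL : Filter.Tendsto (fun x : ℕ => Real.log (Real.log (x : ℝ))) Filter.atTop Filter.atTop :=
    Real.tendsto_log_atTop.comp hL
  -- the thresholds
  set c₁ : ℝ := max 2 (3 * t) with hc₁
  have hc₁0 : 0 < c₁ := lt_of_lt_of_le two_pos (le_max_left _ _)
  set s₀ : ℝ := max 1 (33 / ε) with hs₀
  have hev1 : ∀ᶠ x : ℕ in Filter.atTop,
      Real.log (Real.log (x : ℝ)) ^ δ * Real.exp (-(δ / 4) * Real.log (Real.log (x : ℝ))) ≤ 1 :=
    ((tendsto_rpow_mul_exp_neg_mul_atTop_nhds_zero δ (δ / 4) hδ4).comp hLL).eventually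
      (Iic_mem_nhds one_pos)
  have hev2 : ∀ᶠ x : ℕ in Filter.atTop,
      ‖Real.log (Real.log (x : ℝ))‖ ≤ (1 / (ε * c₁)) * ‖Real.log (x : ℝ)‖ :=
    hL.eventually (Real.isLittleO_log_id_atTop.bound (by positivity))
  have hev3 : ∀ᶠ x : ℕ in Filter.atTop, s₀ ≤ Real.log (Real.log (x : ℝ)) :=
    hLL.eventually_ge_atTop s₀
  have hev4 : ∀ᶠ x : ℕ in Filter.atTop, (3 : ℝ) ≤ Real.log (x : ℝ) := hL.eventually_ge_atTop 3
  filter_upwards [hev1, hev2, hev3, hev4] with x h1 h2 h3 h4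
  -- notation
  set L : ℝ := Real.log (x : ℝ) with hLdef
  set s : ℝ := Real.log L with hsdef
  have hL0 : 0 < L := by linarith
  have hx1 : (1 : ℝ) < x := by
    by_contra hle
    rw [not_lt] at hle
    have : L ≤ 0 := Real.log_nonpos (Nat.cast_nonneg x) hle
    linarith
  have hx0 : (0 : ℝ) < x := by linarith
  have hs1 : 1 ≤ s := le_trans (le_max_left _ _) h3
  have hs0 : 0 < s := by linarith
  have hs33 : 33 / ε ≤ s := le_trans (le_max_right _ _) h3
  have hexps : Real.exp s = L := by rw [hsdef, Real.exp_log hL0]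
  set u : ℝ := L / (ε * s) with hudef
  have hεs0 : 0 < ε * s := by positivity
  have hu0 : 0 < u := by positivity
  have hLu : L / u = ε * s := by
    rw [hudef]; field_simp
  -- `u ≥ c₁`, from `log L ≤ L/(ε c₁)`
  have huc : c₁ ≤ u := by
    have h2' : s ≤ (1 / (ε * c₁)) * L := by
      have := h2
      rw [Real.norm_of_nonneg hs0.le, Real.norm_of_nonneg hL0.le] at this
      exact this
    rw [hudef, le_div_iff₀ hεs0]
    calc c₁ * (ε * s) ≤ c₁ * (ε * ((1 / (ε * c₁)) * L)) := by gcongr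
      _ = L := by field_simp
  have hu2 : 2 ≤ u := le_trans (le_max_left _ _) huc
  have hu3t : 3 * t ≤ u := le_trans (le_max_right _ _) huc
  -- the parameter `z = e^u`
  set z : ℝ := Real.exp u with hzdef
  have hlogz : Real.log z = u := by rw [hzdef, Real.log_exp]
  have hz4 : 4 ≤ z := by
    rw [hzdef]
    have h22 : Real.exp 2 ≤ Real.exp u := Real.exp_le_exp.2 hu2
    have : (4 : ℝ) ≤ Real.exp 2 := by
      have := Real.add_one_le_exp (1 : ℝ)
      have h' : Real.exp 2 = Real.exp 1 * Real.exp 1 := by rw [← Real.exp_add]; norm_num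
      nlinarith [Real.exp_pos (1 : ℝ)]
    linarith
  -- the absorption condition `z^10 log z ≤ x^{1/3}`
  have hcond : z ^ (10 : ℕ) * Real.log z ≤ (x : ℝ) ^ ((1 : ℝ) / 3) := by
    rw [hlogz, hzdef, ← Real.exp_nat_mul, Real.rpow_def_of_pos hx0, ← hLdef]
    have hu_exp : u ≤ Real.exp u := by linarith [Real.add_one_le_exp u]
    calc Real.exp ((10 : ℕ) * u) * u ≤ Real.exp ((10 : ℕ) * u) * Real.exp u :=
          mul_le_mul_of_nonneg_left hu_exp (Real.exp_pos _).le
      _ = Real.exp (11 * u) := by rw [← Real.exp_add]; push_cast; ring_nf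
      _ ≤ Real.exp (L * (1 / 3)) := by
          rw [Real.exp_le_exp, hudef]
          have h33 : 33 ≤ ε * s := by
            rw [div_le_iff₀ hε0] at hs33; linarith
          rw [show 11 * (L / (ε * s)) = L * (11 / (ε * s)) by ring]
          refine mul_le_mul_of_nonneg_left ?_ hL0.le
          rw [div_le_iff₀ hεs0]
          linarith
  intro h hh
  -- apply the main estimate (uniform in `h`)
  have hb := hcore h hh x z t hz4 ht0 (by rw [hlogz]; exact hu3t) hcond
  rw [hlogz, hLu] at hb
  -- identify the two terms
  have hΞ : (n : ℝ) ^ (ε * s) = Real.exp (δ / 2 * s) := by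
    rw [Real.rpow_def_of_pos hn0, ← mul_assoc, hεn]
  have hT1 : (n : ℝ) ^ (ε * s) * (A₁ * u ^ (-δ)) =
      A₁ * ε ^ δ * (s ^ δ * Real.exp (-(δ / 2) * s)) := by
    rw [hΞ, hudef, Real.rpow_def_of_pos hu0, Real.log_div hL0.ne' hεs0.ne', ← hsdef]
    have e1 : ε ^ δ * s ^ δ = Real.exp (Real.log (ε * s) * δ) := by
      rw [← Real.mul_rpow hε0.le hs0.le, Real.rpow_def_of_pos hεs0]
    calc Real.exp (δ / 2 * s) * (A₁ * Real.exp ((s - Real.log (ε * s)) * -δ))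
        = A₁ * (Real.exp (Real.log (ε * s) * δ) * Real.exp (-(δ / 2) * s)) := by
          rw [mul_comm (Real.exp (δ / 2 * s)), mul_assoc, ← Real.exp_add, ← Real.exp_add]
          congr 2
          ring
      _ = A₁ * ε ^ δ * (s ^ δ * Real.exp (-(δ / 2) * s)) := by rw [← e1]; ring
  have hT2 : (n : ℝ) ^ (ε * s) * (A₂ * Real.exp (B * t * Real.exp t) * u *
      Real.exp (-(t / 3) * (ε * s))) = A₂' / (ε * s) * Real.exp (-s) := by
    rw [hΞ, hA₂', hudef, ← hexps]
    have e1 : -(t / 3) * (ε * s) = -((t / 3 * ε) * s) := by ring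
    rw [e1, htε]
    calc Real.exp (δ / 2 * s) * (A₂ * Real.exp (B * t * Real.exp t) * (Real.exp s / (ε * s)) *
          Real.exp (-((2 + δ / 2) * s)))
        = A₂ * Real.exp (B * t * Real.exp t) / (ε * s) *
            (Real.exp (δ / 2 * s) * Real.exp s * Real.exp (-((2 + δ / 2) * s))) := by ring
      _ = A₂ * Real.exp (B * t * Real.exp t) / (ε * s) * Real.exp (-s) := by
          rw [← Real.exp_add, ← Real.exp_add]
          congr 2
          ring
  have hT2le : A₂' / (ε * s) * Real.exp (-s) ≤ A₂' / ε * Real.exp (-s) := by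
    refine mul_le_mul_of_nonneg_right ?_ (Real.exp_pos _).le
    refine div_le_div_of_nonneg_left hA₂'0 hε0 ?_
    calc ε = ε * 1 := (mul_one ε).symm
      _ ≤ ε * s := mul_le_mul_of_nonneg_left hs1 hε0.le
  -- the rate: both terms are `≤ const · e^{-(δ/4) s}` and `e^{-(δ/4) s} = L^{-δ/4}`
  set w : ℝ := Real.exp (-(δ / 4) * s) with hwdef
  have hw0 : 0 < w := Real.exp_pos _
  have hwL : w = L ^ (-(δ / 4)) := by
    rw [hwdef, Real.rpow_def_of_pos hL0, ← hsdef]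
    congr 1
    ring
  have hsplit : Real.exp (-(δ / 2) * s) = w * w := by
    rw [hwdef, ← Real.exp_add]
    congr 1
    ring
  have hterm1 : s ^ δ * Real.exp (-(δ / 2) * s) ≤ w := by
    rw [hsplit, ← mul_assoc]
    calc s ^ δ * w * w ≤ 1 * w := mul_le_mul_of_nonneg_right h1 hw0.le
      _ = w := one_mul w
  have hterm2 : Real.exp (-s) ≤ w := by
    rw [hwdef, Real.exp_le_exp]
    have hδ41 : δ / 4 ≤ 1 := by linarith
    have hmul : δ / 4 * s ≤ 1 * s := mul_le_mul_of_nonneg_right hδ41 hs0.le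
    linarith
  have hsq0 : 0 ≤ Real.sqrt (h.natAbs) := Real.sqrt_nonneg _
  have hεδ0 : 0 ≤ A₁ * ε ^ δ := by positivity
  have hA₂ε0 : 0 ≤ A₂' / ε := by positivity
  have hinner : (n : ℝ) ^ (ε * s) * x * (A₁ * u ^ (-δ) +
      A₂ * Real.exp (B * t * Real.exp t) * u * Real.exp (-(t / 3) * (ε * s)))
        ≤ (A₁ * ε ^ δ + A₂' / ε) * w * x := by
    calc (n : ℝ) ^ (ε * s) * x * (A₁ * u ^ (-δ) +
          A₂ * Real.exp (B * t * Real.exp t) * u * Real.exp (-(t / 3) * (ε * s)))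
        = x * ((n : ℝ) ^ (ε * s) * (A₁ * u ^ (-δ)) + (n : ℝ) ^ (ε * s) *
            (A₂ * Real.exp (B * t * Real.exp t) * u * Real.exp (-(t / 3) * (ε * s)))) := by ring
      _ = x * (A₁ * ε ^ δ * (s ^ δ * Real.exp (-(δ / 2) * s)) + A₂' / (ε * s) * Real.exp (-s)) := by
          rw [hT1, hT2]
      _ ≤ x * (A₁ * ε ^ δ * w + A₂' / ε * w) := by
          refine mul_le_mul_of_nonneg_left ?_ hx0.le
          exact add_le_add (mul_le_mul_of_nonneg_left hterm1 hεδ0)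
            (hT2le.trans (mul_le_mul_of_nonneg_left hterm2 hA₂ε0))
      _ = (A₁ * ε ^ δ + A₂' / ε) * w * x := by ring
  calc ‖∑ d ∈ Icc 1 x, polyRootWeylSum f d h‖
      ≤ Real.sqrt (h.natAbs) * ((n : ℝ) ^ (ε * s) * x * (A₁ * u ^ (-δ) +
          A₂ * Real.exp (B * t * Real.exp t) * u * Real.exp (-(t / 3) * (ε * s)))) := hb
    _ ≤ Real.sqrt (h.natAbs) * ((A₁ * ε ^ δ + A₂' / ε) * w * x) :=
        mul_le_mul_of_nonneg_left hinner hsq0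
    _ = (A₁ * ε ^ δ + A₂' / ε) * Real.sqrt (h.natAbs) * x * L ^ (-(δ / 4)) := by
        rw [← hwL]; ring

/-- **Block form with the rate.** [this work]  For `g` irreducible of degree `≥ 2`, with the `δ₁, K` of the
previous theorem: there is `x₀` such that for all `x₀ ≤ E ≤ E'` and all `h ≠ 0`,
`|∑_{E < e ≤ E'} S_g(h; e)| ≤ 2 K √|h| · E' · (log E)^{−δ₁}`. -/
theorem exists_norm_sum_Ioc_hooleySum_le_logPow {g : ℤ[X]} (hirr : Irreducible g)
    (hdeg : 2 ≤ g.natDegree) :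
    ∃ δ₁ : ℝ, 0 < δ₁ ∧ ∃ K : ℝ, 0 ≤ K ∧ ∃ x₀ : ℕ, ∀ E E' : ℕ, x₀ ≤ E → E ≤ E' →
      ∀ h : ℤ, h ≠ 0 →
        ‖∑ e ∈ Ioc E E', hooleySum g e h‖ ≤
          2 * K * Real.sqrt (h.natAbs) * E' * Real.log E ^ (-δ₁) := by
  obtain ⟨δ₁, hδ₁, K, hK, hev⟩ := exists_eventually_norm_sum_polyRootWeylSum_le_logPow hirr hdeg
  obtain ⟨x₀, hx₀⟩ := eventually_atTop.1 hev
  refine ⟨δ₁, hδ₁, K, hK, max x₀ 2, fun E E' hE hEE' h hh => ?_⟩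
  have hx₀E : x₀ ≤ E := le_trans (le_max_left _ _) hE
  have hE2 : 2 ≤ E := le_trans (le_max_right _ _) hE
  have hEr : (2 : ℝ) ≤ E := by exact_mod_cast hE2
  have hE'r : (E : ℝ) ≤ E' := by exact_mod_cast hEE'
  have hlogE : 0 < Real.log E := Real.log_pos (by linarith)
  have hlogEE' : Real.log E ≤ Real.log E' := Real.log_le_log (by linarith) hE'r
  have hpowle : Real.log E' ^ (-δ₁) ≤ Real.log E ^ (-δ₁) :=
    Real.rpow_le_rpow_of_nonpos hlogE hlogEE' (by linarith)
  have hpow0 : 0 ≤ Real.log E ^ (-δ₁) := Real.rpow_nonneg hlogE.le _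
  have hsq0 : 0 ≤ Real.sqrt (h.natAbs) := Real.sqrt_nonneg _
  have h1 := hx₀ E' (hx₀E.trans hEE') h hh
  have h2 := hx₀ E hx₀E h hh
  have hKs : 0 ≤ K * Real.sqrt (h.natAbs) := mul_nonneg hK hsq0
  have h1' : K * Real.sqrt (h.natAbs) * E' * Real.log E' ^ (-δ₁)
      ≤ K * Real.sqrt (h.natAbs) * E' * Real.log E ^ (-δ₁) :=
    mul_le_mul_of_nonneg_left hpowle (by positivity)
  have h2' : K * Real.sqrt (h.natAbs) * E * Real.log E ^ (-δ₁)
      ≤ K * Real.sqrt (h.natAbs) * E' * Real.log E ^ (-δ₁) :=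
    mul_le_mul_of_nonneg_right (mul_le_mul_of_nonneg_left hE'r hKs) hpow0
  calc ‖∑ e ∈ Ioc E E', hooleySum g e h‖
      ≤ ‖∑ k ∈ Icc 1 E', polyRootWeylSum g k h‖ + ‖∑ k ∈ Icc 1 E, polyRootWeylSum g k h‖ :=
        norm_sum_Ioc_hooleySum_le_add g h hEE'
    _ ≤ K * Real.sqrt (h.natAbs) * E' * Real.log E' ^ (-δ₁)
        + K * Real.sqrt (h.natAbs) * E * Real.log E ^ (-δ₁) := add_le_add h1 h2
    _ ≤ K * Real.sqrt (h.natAbs) * E' * Real.log E ^ (-δ₁)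
        + K * Real.sqrt (h.natAbs) * E' * Real.log E ^ (-δ₁) := add_le_add h1' h2'
    _ = 2 * K * Real.sqrt (h.natAbs) * E' * Real.log E ^ (-δ₁) := by ring

end Summit.Parity.BatemanHorn.Theorems
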